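import Summits.Ventures.PercRepro.Night2FatZLoads
import Summits.Ventures.PercRepro.Night2FatXGenericLarge

/-!
# night-2: the fat case — a FREE point closes `N ≥ 8` without any regime hypothesis

A point `y` of `W ∖ {x}` is FREE when it lies on no basis line (`rk {a, b, y} = 3` for all basis points `a ≠ b`)
and, for every basis point `a`, it is the only point of `W ∖ {x}` on the class line through `a` and `y`
(`y' ∈ clF {a, y}` for a second point `y'` of `W ∖ {x}` forces `rk ({a, y} ∪ {w₀, x}) ≥ 4`).  Then every loaded
target `T ∋ x, y` has `Y ∖ {y}` inside the set `S` of points of `W ∖ {x}` lying on a CLASS BASIS LINE (a line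
`clF {a, b}` through two basis points coplanar with the off-points): a distance-1 line would put `y` on a basis
line; a distance-2 line is a class line with `|R| = |Y|`, misses at most one point of `Y`, cannot contain `y`
(`R ⊆ clF {a, y}` would make the class line through `a, y` carry a second point of `Y`) and so is
`(Y ∖ {y}) ∪ {a, b}` for two basis points `a, b` (`sdiff_subset_classLines_of_loaded_of_free`).  The loaded
targets through `x, y` at level `j` number `≤ C(|S|, j − 2)` (`card_loaded_targets_through_free_le'`), the
unloaded ones `≥ C(N − 2, j − 2) − C(|S|, j − 2)` (`fat_count_level_ge_free_point'`), and the numerics of gen 33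
give the fair share for `N ≥ 8` and `|S| + 5 ≤ |W ∖ {x}|`: **`basis_pair_fair_fat_of_free_point'`** — valid in
EVERY regime of the fat case (the degenerate two-planes regime included).  Paper `proofs/NIGHT-2-g34.md` §6′.
-/

namespace PercRepro.Shadow

open PercRepro.ThmH PercRepro.PerFlat

variable {α : Type*} [DecidableEq α] {M : Matroid α} [M.Finite] {G : Finset α}

/-- **A loaded target through a free point has the rest of its `Y` on class basis lines.** -/
theorem sdiff_subset_classLines_of_loaded_of_free (hG : G ∈ flatsQ M (5 + 1)) (hd : (gr M \ G).card = 2)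
    (hk : kColoops M G = 1) (hs : ∀ e ∈ gr M, ∀ f ∈ gr M, e ≠ f → rkN M {e, f} = 2)
    (hl : ∀ e ∈ gr M, M.Indep {e}) (hfat : (fatClosures M 5 G 2).card ≤ 1) {B₀ : Finset α}
    (hB₀ : B₀ ∈ thinMembers M 5 G) {w₀ x : α} (hD : G \ clF M B₀ = {w₀, x})
    {B : Finset α} (hB : B ∈ thinMembers M 5 G) (hnP : ¬ bigP M G B) {z : α} (hz : z ∈ G \ clF M B)
    (hxQ : x ∉ insert z B) {y : α} (hy : y ∈ (G \ insert z B).erase x)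
    (hfree : ∀ a ∈ (insert z B \ coloops M G).erase w₀, ∀ b ∈ (insert z B \ coloops M G).erase w₀, a ≠ b →
      rkN M {a, b, y} = 3)
    (hfree' : ∀ a ∈ (insert z B \ coloops M G).erase w₀, ∀ y' ∈ (G \ insert z B).erase x, y' ≠ y →
      y' ∈ clF M {a, y} → 4 ≤ rkN M (insert w₀ (insert x {a, y})))
    {T : Finset α} (hT : T ∈ tgtSets M 5 G B z) (hxT : x ∈ T) (hyT : y ∈ T)
    (hload : dload M 5 G (bigP M G) (dshGT2 M 5 G) T ≠ 0) :
    ∀ e ∈ ((T \ insert z B).erase x).erase y, ∃ a ∈ (insert z B \ coloops M G).erase w₀,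
      ∃ b ∈ (insert z B \ coloops M G).erase w₀, a ≠ b ∧ e ∈ clF M {a, b} ∧
        rkN M (insert w₀ (insert x {a, b})) ≤ 3 := by
  have hGg : G ⊆ gr M := (mem_flatsQ.1 hG).1
  have hd' : (gr M \ G).card ≤ 5 := by omega
  have hTG : T ⊆ G := subset_G_of_mem_shadowAt (mem_tgtSets.1 hT).1
  have hyx : y ≠ x := (Finset.mem_erase.1 hy).1
  have hyG : y ∈ G \ insert z B := Finset.mem_of_mem_erase hy
  have hyg : y ∈ gr M := hGg (Finset.mem_sdiff.1 hyG).1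
  have hyY : y ∈ (T \ insert z B).erase x :=
    Finset.mem_erase.2 ⟨hyx, Finset.mem_sdiff.2 ⟨hyT, (Finset.mem_sdiff.1 hyG).2⟩⟩
  have hKB : coloops M G ⊆ B := coloops_subset_of_mem_thinMembers hG hd' hB
  have hKQ : coloops M G ⊆ insert z B := hKB.trans (Finset.subset_insert _ _)
  have hw₀G : w₀ ∈ G ∧ w₀ ∉ clF M B₀ := by
    have : w₀ ∈ G \ clF M B₀ := by rw [hD]; exact Finset.mem_insert_self _ _
    exact Finset.mem_sdiff.1 this
  obtain ⟨R, hR, hR2, hR3, hcase⟩ := loaded_fat_target_dichotomy hG hd hk hs hl hfat hB₀ hD hTG hload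
  have hRg : R ⊆ gr M := fun r hr => hGg (hTG (Finset.mem_sdiff.1 (Finset.mem_sdiff.1 (hR hr)).1).1)
  -- a point of `R` in `Q` is a basis point (not `w₀`, not a coloop)
  have hRP₀ : ∀ r ∈ R, r ∈ insert z B → r ∈ (insert z B \ coloops M G).erase w₀ := by
    intro r hr hrQ
    have h1 := Finset.mem_sdiff.1 (hR hr)
    rw [Finset.mem_insert, Finset.mem_singleton, not_or] at h1
    exact Finset.mem_erase.2 ⟨h1.2.1, Finset.mem_sdiff.2 ⟨hrQ, (Finset.mem_sdiff.1 h1.1).2⟩⟩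
  rcases hcase with ⟨hRc, -⟩ | ⟨hRc, hRcls⟩
  · -- distance one: `y` would lie on a basis line
    exfalso
    obtain ⟨a, ha, b, hb, hab, hrk⟩ :=
      exists_basis_line_of_dist_one_fat hG hd hk hs hB hnP hz hT hxT hxQ hR hR2 hRc
    have hsub : ({a, b, y} : Finset α) ⊆ insert a (insert b ((T \ insert z B).erase x)) := by
      intro e he
      rw [Finset.mem_insert, Finset.mem_insert, Finset.mem_singleton] at he
      rw [Finset.mem_insert, Finset.mem_insert]
      rcases he with rfl | rfl | rfl
      · exact Or.inl rfl
      · exact Or.inr (Or.inl rfl)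
      · exact Or.inr (Or.inr hyY)
    have h1 := rkN_mono (M := M) hsub
    rw [hrk, hfree a ha b hb hab] at h1
    omega
  · -- distance two
    obtain ⟨hY1, hRQ2⟩ := card_sdiff_line_le_one_of_dist_two hG hd hk hB hnP hz hT hxT hxQ hR hR2 hRc
    have hlev := card_sdiff_coloops_eq_level_add_five hG hd hk hB hnP hz hT
    have hxTQ : x ∈ T \ insert z B := Finset.mem_sdiff.2 ⟨hxT, hxQ⟩
    have hY : ((T \ insert z B).erase x).card + 1 = (T \ insert z B).card := by
      rw [Finset.card_erase_of_mem hxTQ]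
      have : 0 < (T \ insert z B).card := Finset.card_pos.2 ⟨x, hxTQ⟩
      omega
    have hRsplit : R ⊆ (R ∩ insert z B) ∪ (((T \ insert z B).erase x) ∩ R) := by
      intro r hr
      rw [Finset.mem_union, Finset.mem_inter, Finset.mem_inter]
      by_cases hrQ : r ∈ insert z B
      · exact Or.inl ⟨hr, hrQ⟩
      · refine Or.inr ⟨Finset.mem_erase.2 ⟨?_, Finset.mem_sdiff.2
          ⟨(Finset.mem_sdiff.1 (Finset.mem_sdiff.1 (hR hr)).1).1, hrQ⟩⟩, hr⟩
        intro h'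
        exact (Finset.mem_sdiff.1 (hR hr)).2 (h' ▸ Finset.mem_insert_of_mem (Finset.mem_singleton_self _))
    have hYR : (((T \ insert z B).erase x) ∩ R).card + (((T \ insert z B).erase x) \ R).card =
        ((T \ insert z B).erase x).card := Finset.card_inter_add_card_sdiff _ _
    have hcard := Finset.card_le_card hRsplit
    have hcu := Finset.card_union_le (R ∩ insert z B) (((T \ insert z B).erase x) ∩ R)
    have hyR : y ∉ R := by
      intro hyR
      -- `R` has a basis point `a`; `R ⊆ clF {a, y}`, and `R` has a second point of `Y`
      have h1le : 1 ≤ (R ∩ insert z B).card := by omega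
      obtain ⟨a, ha⟩ := Finset.card_pos.1 (by omega : 0 < (R ∩ insert z B).card)
      have haR : a ∈ R := (Finset.mem_inter.1 ha).1
      have haP₀ := hRP₀ a haR (Finset.mem_inter.1 ha).2
      have hay : a ≠ y := fun h' => (Finset.mem_sdiff.1 hyG).2 (h' ▸ (Finset.mem_inter.1 ha).2)
      have hayg : ({a, y} : Finset α) ⊆ gr M :=
        Finset.insert_subset (hRg haR) (Finset.singleton_subset_iff.2 hyg)
      have hRay : R ⊆ clF M {a, y} :=
        subset_clF_of_rkN_le_two_of_two_mem hs hRg (by omega) haR hyR hay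
          (subset_clF_of_subset_gr hayg (Finset.mem_insert_self _ _))
          (subset_clF_of_subset_gr hayg (Finset.mem_insert_of_mem (Finset.mem_singleton_self _)))
      -- a second point of `Y` on `R`: `|Y ∩ R| ≥ |Y| − 1 ≥ 2` when `|R ∩ Q| = 1`, else two basis points on `R`
      have hcls : rkN M (insert w₀ (insert x {a, y})) ≤ 3 := by
        have : insert w₀ (insert x {a, y}) ⊆ insert w₀ (insert x R) :=
          Finset.insert_subset_insert _ (Finset.insert_subset_insert _
            (Finset.insert_subset haR (Finset.singleton_subset_iff.2 hyR)))
        exact (rkN_mono this).trans hRcls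
      by_cases h2 : 2 ≤ (R ∩ insert z B).card
      · obtain ⟨a₁, ha₁, b₁, hb₁, hab₁⟩ := Finset.one_lt_card.1 (by omega : 1 < (R ∩ insert z B).card)
        have h3 : ({a₁, b₁, y} : Finset α) ⊆ R :=
          Finset.insert_subset (Finset.mem_inter.1 ha₁).1 (Finset.insert_subset
            (Finset.mem_inter.1 hb₁).1 (Finset.singleton_subset_iff.2 hyR))
        have := rkN_mono (M := M) h3
        rw [hfree a₁ (hRP₀ a₁ (Finset.mem_inter.1 ha₁).1 (Finset.mem_inter.1 ha₁).2) b₁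
          (hRP₀ b₁ (Finset.mem_inter.1 hb₁).1 (Finset.mem_inter.1 hb₁).2) hab₁, hR2] at this
        omega
      · have hYR2 : 2 ≤ (((T \ insert z B).erase x) ∩ R).card := by omega
        obtain ⟨y', hy', hy'y⟩ := Finset.exists_mem_ne (by omega : 1 < (((T \ insert z B).erase x) ∩ R).card) y
        have hy'W : y' ∈ (G \ insert z B).erase x := by
          have h := Finset.mem_inter.1 hy'
          exact Finset.mem_erase.2 ⟨(Finset.mem_erase.1 h.1).1,
            Finset.sdiff_subset_sdiff hTG (Finset.Subset.refl _) (Finset.mem_of_mem_erase h.1)⟩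
        have := hfree' a haP₀ y' hy'W hy'y (hRay (Finset.mem_inter.1 hy').2)
        omega
    -- `y ∉ R`: `R ⊇ Y ∖ {y}` and `R` has two basis points
    have hy₃' : y ∈ ((T \ insert z B).erase x) \ R := Finset.mem_sdiff.2 ⟨hyY, hyR⟩
    have hpos : 0 < (((T \ insert z B).erase x) \ R).card := Finset.card_pos.2 ⟨y, hy₃'⟩
    obtain ⟨a, ha, b, hb, hab⟩ := Finset.one_lt_card.1 (by omega : 1 < (R ∩ insert z B).card)
    have haR : a ∈ R := (Finset.mem_inter.1 ha).1
    have hbR : b ∈ R := (Finset.mem_inter.1 hb).1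
    have habg : ({a, b} : Finset α) ⊆ gr M :=
      Finset.insert_subset (hRg haR) (Finset.singleton_subset_iff.2 (hRg hbR))
    have hRab : R ⊆ clF M {a, b} :=
      subset_clF_of_rkN_le_two_of_two_mem hs hRg (by omega) haR hbR hab
        (subset_clF_of_subset_gr habg (Finset.mem_insert_self _ _))
        (subset_clF_of_subset_gr habg (Finset.mem_insert_of_mem (Finset.mem_singleton_self _)))
    have hcls : rkN M (insert w₀ (insert x {a, b})) ≤ 3 := by
      have : insert w₀ (insert x {a, b}) ⊆ insert w₀ (insert x R) :=
        Finset.insert_subset_insert _ (Finset.insert_subset_insert _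
          (Finset.insert_subset haR (Finset.singleton_subset_iff.2 hbR)))
      exact (rkN_mono this).trans hRcls
    intro e he
    have heY : e ∈ (T \ insert z B).erase x := Finset.mem_of_mem_erase he
    have hey : e ≠ y := (Finset.mem_erase.1 he).1
    have heR : e ∈ R := by
      by_contra heR
      have hsub : ({e, y} : Finset α) ⊆ ((T \ insert z B).erase x) \ R := by
        intro u hu
        rw [Finset.mem_insert, Finset.mem_singleton] at hu
        rcases hu with rfl | rfl
        · exact Finset.mem_sdiff.2 ⟨heY, heR⟩
        · exact hy₃'
      have := Finset.card_le_card hsub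
      rw [Finset.card_pair hey] at this
      omega
    exact ⟨a, hRP₀ a haR (Finset.mem_inter.1 ha).2, b, hRP₀ b hbR (Finset.mem_inter.1 hb).2, hab,
      hRab heR, hcls⟩

open scoped Classical in
/-- **The loaded targets through `x` and a free point `y` at level `j` number at most `C(|S|, j − 2)`**,
`S` the points of `W ∖ {x}` on class basis lines. -/
theorem card_loaded_targets_through_free_le' (hG : G ∈ flatsQ M (5 + 1)) (hd : (gr M \ G).card = 2)
    (hk : kColoops M G = 1) (hs : ∀ e ∈ gr M, ∀ f ∈ gr M, e ≠ f → rkN M {e, f} = 2)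
    (hl : ∀ e ∈ gr M, M.Indep {e}) (hfat : (fatClosures M 5 G 2).card ≤ 1) {B₀ : Finset α}
    (hB₀ : B₀ ∈ thinMembers M 5 G) {w₀ x : α} (hD : G \ clF M B₀ = {w₀, x})
    {B : Finset α} (hB : B ∈ thinMembers M 5 G) (hnP : ¬ bigP M G B) {z : α} (hz : z ∈ G \ clF M B)
    (hxQ : x ∉ insert z B) {y : α} (hy : y ∈ (G \ insert z B).erase x)
    (hfree : ∀ a ∈ (insert z B \ coloops M G).erase w₀, ∀ b ∈ (insert z B \ coloops M G).erase w₀, a ≠ b →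
      rkN M {a, b, y} = 3)
    (hfree' : ∀ a ∈ (insert z B \ coloops M G).erase w₀, ∀ y' ∈ (G \ insert z B).erase x, y' ≠ y →
      y' ∈ clF M {a, y} → 4 ≤ rkN M (insert w₀ (insert x {a, y}))) (j : ℕ) :
    ((tgtSets M 5 G B z).filter (fun T => ({x, y} : Finset α) ⊆ T ∧ (T \ insert z B).card = j ∧
      dload M 5 G (bigP M G) (dshGT2 M 5 G) T ≠ 0)).card ≤
      (((G \ insert z B).erase x).filter (fun e => ∃ a ∈ (insert z B \ coloops M G).erase w₀,
        ∃ b ∈ (insert z B \ coloops M G).erase w₀, a ≠ b ∧ e ∈ clF M {a, b} ∧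
          rkN M (insert w₀ (insert x {a, b})) ≤ 3)).card.choose (j - 2) := by
  have hyx : y ≠ x := (Finset.mem_erase.1 hy).1
  have hyG : y ∈ G \ insert z B := Finset.mem_of_mem_erase hy
  rw [← Finset.card_powersetCard]
  apply Finset.card_le_card_of_injOn (fun T => (T \ insert z B) \ {x, y})
  · intro T hT
    rw [Finset.mem_coe, Finset.mem_filter] at hT
    obtain ⟨hTt, hXT, hTj, hload⟩ := hT
    have hTG : T ⊆ G := subset_G_of_mem_shadowAt (mem_tgtSets.1 hTt).1
    have hxT : x ∈ T := hXT (Finset.mem_insert_self _ _)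
    have hyT : y ∈ T := hXT (Finset.mem_insert_of_mem (Finset.mem_singleton_self _))
    have hspine := sdiff_subset_classLines_of_loaded_of_free hG hd hk hs hl hfat hB₀ hD hB hnP hz hxQ hy hfree
      hfree' hTt hxT hyT hload
    rw [Finset.mem_coe, Finset.mem_powersetCard]
    constructor
    · intro e he
      rw [Finset.mem_sdiff, Finset.mem_insert, Finset.mem_singleton, not_or] at he
      obtain ⟨heTQ, hex, hey⟩ := he
      rw [Finset.mem_filter]
      refine ⟨Finset.mem_erase.2 ⟨hex, Finset.sdiff_subset_sdiff hTG (Finset.Subset.refl _) heTQ⟩, ?_⟩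
      exact hspine e (Finset.mem_erase.2 ⟨hey, Finset.mem_erase.2 ⟨hex, heTQ⟩⟩)
    · have hXsub : ({x, y} : Finset α) ⊆ T \ insert z B := by
        intro e he
        rw [Finset.mem_insert, Finset.mem_singleton] at he
        rcases he with rfl | rfl
        · exact Finset.mem_sdiff.2 ⟨hxT, hxQ⟩
        · exact Finset.mem_sdiff.2 ⟨hyT, (Finset.mem_sdiff.1 hyG).2⟩
      rw [Finset.card_sdiff_of_subset hXsub, hTj, Finset.card_pair hyx.symm]
  · intro T₁ hT₁ T₂ hT₂ heq
    rw [Finset.mem_coe, Finset.mem_filter] at hT₁ hT₂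
    have key : ∀ T ∈ tgtSets M 5 G B z, ({x, y} : Finset α) ⊆ T →
        T = insert z B ∪ ({x, y} ∪ ((T \ insert z B) \ {x, y})) := by
      intro T hT hXT
      have hQT : insert z B ⊆ T := (mem_tgtSets.1 hT).2.1
      ext e
      simp only [Finset.mem_union, Finset.mem_sdiff]
      constructor
      · intro heT
        by_cases heQ : e ∈ insert z B
        · exact Or.inl heQ
        · by_cases heX : e ∈ ({x, y} : Finset α)
          · exact Or.inr (Or.inl heX)
          · exact Or.inr (Or.inr ⟨⟨heT, heQ⟩, heX⟩)
      · rintro (heQ | heX | ⟨⟨heT, -⟩, -⟩)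
        · exact hQT heQ
        · exact hXT heX
        · exact heT
    rw [key T₁ hT₁.1 hT₁.2.1, key T₂ hT₂.1 hT₂.2.1]
    simp only at heq
    rw [heq]

/-- **The unloaded targets through `x` and a free point `y` at level `j ≥ 2`** number at least
`C(N − 2, j − 2) − C(|S|, j − 2)`, each worth `fatTerm j (11/18)`. -/
theorem fat_count_level_ge_free_point' (hG : G ∈ flatsQ M (5 + 1)) (hd : (gr M \ G).card = 2)
    (hk : kColoops M G = 1) (hs : ∀ e ∈ gr M, ∀ f ∈ gr M, e ≠ f → rkN M {e, f} = 2)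
    (hl : ∀ e ∈ gr M, M.Indep {e}) (hfat : (fatClosures M 5 G 2).card ≤ 1) {B₀ : Finset α}
    (hB₀ : B₀ ∈ thinMembers M 5 G) {w₀ x : α} (hD : G \ clF M B₀ = {w₀, x})
    {B : Finset α} (hB : B ∈ thinMembers M 5 G) (hnP : ¬ bigP M G B) {z : α} (hz : z ∈ G \ clF M B)
    (hx : x ∈ G \ insert z B) {y : α} (hy : y ∈ (G \ insert z B).erase x)
    (hfree : ∀ a ∈ (insert z B \ coloops M G).erase w₀, ∀ b ∈ (insert z B \ coloops M G).erase w₀, a ≠ b →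
      rkN M {a, b, y} = 3)
    (hfree' : ∀ a ∈ (insert z B \ coloops M G).erase w₀, ∀ y' ∈ (G \ insert z B).erase x, y' ≠ y →
      y' ∈ clF M {a, y} → 4 ≤ rkN M (insert w₀ (insert x {a, y}))) {j : ℕ} (hj : 2 ≤ j) :
    ((((G \ insert z B).card - 2).choose (j - 2) -
      (((G \ insert z B).erase x).filter (fun e => ∃ a ∈ (insert z B \ coloops M G).erase w₀,
        ∃ b ∈ (insert z B \ coloops M G).erase w₀, a ≠ b ∧ e ∈ clF M {a, b} ∧
          rkN M (insert w₀ (insert x {a, b})) ≤ 3)).card.choose (j - 2) : ℕ) : ℚ) *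
      fatTerm j (11 / 18) ≤
      ∑ T ∈ ((tgtSets M 5 G B z).filter
        (fun T => x ∈ T ∧ dload M 5 G (bigP M G) (dshGT2 M 5 G) T = 0)).filter
        (fun T => (T \ insert z B).card = j),
        capS M 5 G T / ((221 / 360 : ℚ) * ((2 * ((T \ coloops M G).card - 2).choose 4 : ℕ) : ℚ)) := by
  have hd' : (gr M \ G).card ≤ 5 := by omega
  have hyx : y ≠ x := (Finset.mem_erase.1 hy).1
  have hX : ({x, y} : Finset α) ⊆ G \ insert z B := by
    intro e he
    rw [Finset.mem_insert, Finset.mem_singleton] at he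
    rcases he with rfl | rfl
    · exact hx
    · exact Finset.mem_of_mem_erase hy
  have hX2 : ({x, y} : Finset α).card = 2 := Finset.card_pair hyx.symm
  have hcount := choose_le_card_targets_level hG hB hz hX (by omega : 1 ≤ j) (by rw [hX2]; exact hj)
  rw [hX2] at hcount
  set A := (tgtSets M 5 G B z).filter (fun T => ({x, y} : Finset α) ⊆ T ∧ (T \ insert z B).card = j) with hA
  have hsplit := Finset.card_filter_add_card_filter_not
    (s := A) (fun T => dload M 5 G (bigP M G) (dshGT2 M 5 G) T = 0)
  have hloaded := card_loaded_targets_through_free_le' hG hd hk hs hl hfat hB₀ hD hB hnP hz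
    (Finset.mem_sdiff.1 hx).2 hy hfree hfree' j
  have hloadsub : A.filter (fun T => ¬ dload M 5 G (bigP M G) (dshGT2 M 5 G) T = 0) ⊆
      (tgtSets M 5 G B z).filter (fun T => ({x, y} : Finset α) ⊆ T ∧ (T \ insert z B).card = j ∧
        dload M 5 G (bigP M G) (dshGT2 M 5 G) T ≠ 0) := by
    intro T hT
    rw [Finset.mem_filter, hA, Finset.mem_filter] at hT
    rw [Finset.mem_filter]
    exact ⟨hT.1.1, hT.1.2.1, hT.1.2.2, hT.2⟩
  have hl' := le_trans (Finset.card_le_card hloadsub) hloaded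
  set F := ((tgtSets M 5 G B z).filter
    (fun T => x ∈ T ∧ dload M 5 G (bigP M G) (dshGT2 M 5 G) T = 0)).filter
    (fun T => (T \ insert z B).card = j) with hF
  have hsub : A.filter (fun T => dload M 5 G (bigP M G) (dshGT2 M 5 G) T = 0) ⊆ F := by
    intro T hT
    rw [Finset.mem_filter, hA, Finset.mem_filter] at hT
    rw [hF, Finset.mem_filter, Finset.mem_filter]
    exact ⟨⟨hT.1.1, hT.1.2.1 (Finset.mem_insert_self _ _), hT.2⟩, hT.1.2.2⟩
  have hcardU : (((G \ insert z B).card - 2).choose (j - 2) -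
      (((G \ insert z B).erase x).filter (fun e => ∃ a ∈ (insert z B \ coloops M G).erase w₀,
        ∃ b ∈ (insert z B \ coloops M G).erase w₀, a ≠ b ∧ e ∈ clF M {a, b} ∧
          rkN M (insert w₀ (insert x {a, b})) ≤ 3)).card.choose (j - 2) : ℕ) ≤
      (A.filter (fun T => dload M 5 G (bigP M G) (dshGT2 M 5 G) T = 0)).card := by
    omega
  have hterm : ∀ T ∈ F, fatTerm j (11 / 18) ≤
      capS M 5 G T / ((221 / 360 : ℚ) * ((2 * ((T \ coloops M G).card - 2).choose 4 : ℕ) : ℚ)) := by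
    intro T hT
    rw [hF, Finset.mem_filter, Finset.mem_filter] at hT
    obtain ⟨⟨hTt, -, -⟩, hTj⟩ := hT
    have hTG : T ⊆ G := subset_G_of_mem_shadowAt (mem_tgtSets.1 hTt).1
    have hTK : (T \ coloops M G).card = j + 5 := by
      rw [card_sdiff_coloops_eq_level_add_five hG hd hk hB hnP hz hTt, hTj]
    unfold fatTerm
    rw [hTK, show j + 5 - 2 = j + 3 by omega]
    apply div_le_div_of_nonneg_right (capS_ge_eleven_eighteenths_two_one hd hk hTG)
    positivity
  have hpos : 0 ≤ fatTerm j (11 / 18) := by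
    unfold fatTerm
    positivity
  calc ((((G \ insert z B).card - 2).choose (j - 2) -
        (((G \ insert z B).erase x).filter (fun e => ∃ a ∈ (insert z B \ coloops M G).erase w₀,
        ∃ b ∈ (insert z B \ coloops M G).erase w₀, a ≠ b ∧ e ∈ clF M {a, b} ∧
          rkN M (insert w₀ (insert x {a, b})) ≤ 3)).card.choose (j - 2) : ℕ) : ℚ) *
        fatTerm j (11 / 18)
      ≤ ((A.filter (fun T => dload M 5 G (bigP M G) (dshGT2 M 5 G) T = 0)).card : ℚ) * fatTerm j (11 / 18) := by
        apply mul_le_mul_of_nonneg_right _ hpos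
        exact_mod_cast hcardU
    _ = ∑ _T ∈ A.filter (fun T => dload M 5 G (bigP M G) (dshGT2 M 5 G) T = 0), fatTerm j (11 / 18) := by
        rw [Finset.sum_const, nsmul_eq_mul]
    _ ≤ ∑ T ∈ A.filter (fun T => dload M 5 G (bigP M G) (dshGT2 M 5 G) T = 0),
        capS M 5 G T / ((221 / 360 : ℚ) * ((2 * ((T \ coloops M G).card - 2).choose 4 : ℕ) : ℚ)) :=
        Finset.sum_le_sum (fun T hT => hterm T (hsub hT))
    _ ≤ _ := by
        apply Finset.sum_le_sum_of_subset_of_nonneg hsub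
        intro T _ _
        exact div_nonneg (capS_nonneg' hG hd' T) (by positivity)

/-- **The fat case of (FAIR) from a free point, in every regime**: `N ≥ 8` and
at most `|W ∖ {x}| − 5` points of `W ∖ {x}` on the spine. -/
theorem basis_pair_fair_fat_of_free_point' (hG : G ∈ flatsQ M (5 + 1)) (hd : (gr M \ G).card = 2)
    (hk : kColoops M G = 1) (hs : ∀ e ∈ gr M, ∀ f ∈ gr M, e ≠ f → rkN M {e, f} = 2)
    (hl : ∀ e ∈ gr M, M.Indep {e}) (hfat : (fatClosures M 5 G 2).card ≤ 1)
    {B₀ : Finset α} (hB₀ : B₀ ∈ thinMembers M 5 G) {w₀ x : α} (hD : G \ clF M B₀ = {w₀, x}) (hne : w₀ ≠ x)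
    {B : Finset α} (hB : B ∈ thinMembers M 5 G) (hnP : ¬ bigP M G B) {z : α} (hz : z ∈ G \ clF M B)
    (hl0 : loss M 5 G B z ≠ 0) (hw₀ : w₀ ∈ insert z B) (hx : x ∉ insert z B) (hN : 8 ≤ (G \ insert z B).card)
    {y : α} (hy : y ∈ (G \ insert z B).erase x)
    (hfree : ∀ a ∈ (insert z B \ coloops M G).erase w₀, ∀ b ∈ (insert z B \ coloops M G).erase w₀, a ≠ b →
      rkN M {a, b, y} = 3)
    (hfree' : ∀ a ∈ (insert z B \ coloops M G).erase w₀, ∀ y' ∈ (G \ insert z B).erase x, y' ≠ y →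
      y' ∈ clF M {a, y} → 4 ≤ rkN M (insert w₀ (insert x {a, y})))
    (ht : (((G \ insert z B).erase x).filter (fun e => ∃ a ∈ (insert z B \ coloops M G).erase w₀,
        ∃ b ∈ (insert z B \ coloops M G).erase w₀, a ≠ b ∧ e ∈ clF M {a, b} ∧
          rkN M (insert w₀ (insert x {a, b})) ≤ 3)).card + 4 ≤ (G \ insert z B).card - 2) :
    loss M 5 G B z ≤ rhoL M 5 G B z * lossIncomeH M 5 G (bigP M G) (dshGT2 M 5 G) B z := by
  have hd' : (gr M \ G).card ≤ 5 := by omega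
  have hxG : x ∈ G \ insert z B := by
    refine Finset.mem_sdiff.2 ⟨?_, hx⟩
    have : x ∈ G \ clF M B₀ := by
      rw [hD]
      exact Finset.mem_insert_of_mem (Finset.mem_singleton_self _)
    exact (Finset.mem_sdiff.1 this).1
  apply basis_pair_fair_of_fat_count_sum hG hd hk hs hl hfat hB₀ hD hne hB hnP hz hl0 hw₀ hx
  have hg0 : ∀ T ∈ (tgtSets M 5 G B z).filter
      (fun T => x ∈ T ∧ dload M 5 G (bigP M G) (dshGT2 M 5 G) T = 0),
      0 ≤ capS M 5 G T / ((221 / 360 : ℚ) * ((2 * ((T \ coloops M G).card - 2).choose 4 : ℕ) : ℚ)) :=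
    fun T _ => div_nonneg (capS_nonneg' hG hd' T) (by positivity)
  have hsum := sum_levels_le_sum hg0 (fun T => (T \ insert z B).card) {1, 3, 4, 5, 6, 7}
  rw [Finset.sum_insert (by decide), Finset.sum_insert (by decide), Finset.sum_insert (by decide),
    Finset.sum_insert (by decide), Finset.sum_insert (by decide), Finset.sum_singleton] at hsum
  have hl1 := fat_count_level_ge' hG hd hk hB hnP hz hxG (j := 1) (by norm_num)
    (fun T hT _ h1 => dload_eq_zero_of_card_sdiff_le_six hG hd hk hs hl
      (by rw [card_sdiff_coloops_eq_level_add_five hG hd hk hB hnP hz hT, h1]))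
  have hl3 := fat_count_level_ge_free_point' hG hd hk hs hl hfat hB₀ hD hB hnP hz hxG hy hfree hfree'
    (j := 3) (by norm_num)
  have hl4 := fat_count_level_ge_free_point' hG hd hk hs hl hfat hB₀ hD hB hnP hz hxG hy hfree hfree'
    (j := 4) (by norm_num)
  have hl5 := fat_count_level_ge_free_point' hG hd hk hs hl hfat hB₀ hD hB hnP hz hxG hy hfree hfree'
    (j := 5) (by norm_num)
  have hl6 := fat_count_level_ge_free_point' hG hd hk hs hl hfat hB₀ hD hB hnP hz hxG hy hfree hfree'
    (j := 6) (by norm_num)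
  have hl7 := fat_count_level_ge_free_point' hG hd hk hs hl hfat hB₀ hD hB hnP hz hxG hy hfree hfree'
    (j := 7) (by norm_num)
  have hnum := fat_count_numeric_line_point ((G \ insert z B).card - 2)
    (((G \ insert z B).erase x).filter (fun e => ∃ a ∈ (insert z B \ coloops M G).erase w₀,
        ∃ b ∈ (insert z B \ coloops M G).erase w₀, a ≠ b ∧ e ∈ clF M {a, b} ∧
          rkN M (insert w₀ (insert x {a, b})) ≤ 3)).card (by omega) ht
  have hc1 : (if (G \ insert z B).card - 1 ≤ 3 then (1 : ℚ) else 11 / 18) = 11 / 18 := by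
    rw [if_neg (by omega)]
  rw [hc1] at hl1
  simp only [Nat.sub_self, Nat.choose_zero_right, Nat.cast_one, one_mul] at hl1
  linarith

end PercRepro.Shadow
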